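import Summits.AtomisticToContinuum.Crystallization.Theorems.ReggeStarCoercivityDefectFreeCrystallizesFunnelSitesCovariance
import Literature.Probability.Process.PointStationaryLaw
import HarnessLib

/-!
# Route `ReggeStarCoercivity`, crux `DefectFreeCrystallizes` (stmt-AtomisticToContinuum-13603), line `palm-good-law`, lead c7
# (skeleton v24, stub S1 `stub_cubicMarkVersion`): a MEASURABLE, ROOT-COVARIANT VERSION OF THE CUBIC MARK

**Theorem** (`stub_cubicMarkVersion`).  For every `δ > 0` there is a set `C ⊆ (configuration, point)`, measurable for the
Giry ⊗ Borel σ-algebra on `Measure ℝ³ × ℝ³` and covariant at the root for EVERY measure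
(`(θ_y μ, -y) ∈ C ↔ (μ, 0) ∈ C`, `θ_y μ = μ.map (· - y)`), which on every rooted `δ`-hard-core configuration
`μ = count|S` (`IsRootedHardCore δ μ`: `0 ∈ S`, `S` `δ`-separated) IS the cubic mark of the line:
`(μ, y) ∈ C ↔ IsCubicSite65 (pts μ) y` (`pts μ = S`; `IsCubicSite65 S y`: `y ∈ S` and `y` is not a hexagonal site of the
bond graph of `S` on the funnel window `(0, 6/5)`).  This is the pair (measurability, covariance) of hypotheses of the
landed `CovariantMecke.stub_covariantMecke`, for a mark that agrees with the intended `FunnelSites.cubicMark65` where it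
matters.

**Proof.**  Work with the RELATIVE BALL EVENTS `A(v, r) = {(μ, y) | 0 < μ (B(y + v, r))}` on a separable normed group `E`.
* Each `A(v, r)` is root-covariant for every measure: `θ_y μ (B(-y + v, r)) = μ (B(v, r))` (`ballEvent_covariant`).
* Each `A(v, r)` is measurable for every measure (`measurableSet_ballEvent`): a measure charges the open ball `B(c, r)` iff
  it charges one of the countably many balls `B(eₙ, s)` (`eₙ` a dense sequence, `s ∈ ℚ`) with `dist c eₙ + s < r` — they
  cover `B(c, r)`, countable subadditivity (`measure_ball_pos_iff`) — so `A(v, r)` is a countable union of products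
  `(open set) × {μ | 0 < μ B}`.
* `C = Mem ∩ Hexᶜ` (`exists_measurable_covariant_version`) with `Mem = ⋂ₙ A(0, ρₙ)`, `ρₙ = 1/(n+1)` ("`y` is an atom"), and
  `Hex = ⋃ {A(w₁, ρₙ) ∩ A(w₂, ρₙ) ∩ A(w₃, ρₙ) ∩ A(w₄, ρₙ) : n ∈ ℕ, w ∈ D, B(w, ρₙ) ⊆ H}`, `D` the range of a dense sequence
  of `E⁴` and `H ⊆ E⁴` the OPEN set of relative positions `(p - y, q - y, t - y, b - y)` of four neighbours realising the
  hexagonal pattern around `y` (the nine bond windows `0 < dist < 6/5` and `t ≠ b`; `exists_open_hexPattern`).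
  Measurability and covariance of `C` are inherited from the `A`'s through the countable set operations.
* Agreement on `μ = count|S`, `S` `δ`-separated: `(μ, y) ∈ A(v, r) ↔ S` meets `B(y + v, r)` (`mem_ballEvent_count_iff`).
  `Mem ↔ y ∈ S` (`forall_exists_near_iff`): two points of `S` in a ball of radius `< δ/2` coincide, so the points of `S`
  accumulating at `y` are one point at distance `0` from `y`.  `Hex ↔` hexagonal (`exists_charged_box_iff`, given
  `y ∈ S`): from the four charged balls pick `p, q, t, b ∈ S` with `(p - y, q - y, t - y, b - y)` in the pattern box
  `⊆ H`; conversely the relative positions of hexagonal witnesses lie in the open `H`, hence in a pattern box around a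
  nearby point of the dense sequence.
All `[folklore]`.
-/

noncomputable section

namespace Summit.AtomisticToContinuum.Crystallization.Theorems.PalmGoodLaw.CubicMarkVersion

open MeasureTheory Set Metric
open Literature.Probability.Process
open Summit.AtomisticToContinuum.Crystallization.Theorems.PalmGoodLaw
open Summit.AtomisticToContinuum.Crystallization.Theorems.PalmUnimodularRigidity.LayeredLawsSelectHcp (pts)

/-! ## Relative open-ball events `{(μ, y) | 0 < μ (B(y + v, r))}` on a separable normed group -/

section BallEvents

variable {E : Type*} [NormedAddCommGroup E]

/-- Inner approximation: a measure charges an open ball iff it charges one of the countably many balls with centre on the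
dense sequence and rational radius sitting inside it with room to spare (they cover the ball). [folklore] -/
theorem measure_ball_pos_iff [TopologicalSpace.SeparableSpace E] [MeasurableSpace E] (μ : Measure E) (c : E) (r : ℝ) :
    0 < μ (ball c r) ↔ ∃ n : ℕ, ∃ s : ℚ, dist c (TopologicalSpace.denseSeq E n) + s < r ∧
      0 < μ (ball (TopologicalSpace.denseSeq E n) s) := by
  constructor
  · intro h
    by_contra H
    refine h.ne' (measure_mono_null (show ball c r ⊆ ⋃ (n : ℕ) (s : ℚ)
      (_ : dist c (TopologicalSpace.denseSeq E n) + s < r), ball (TopologicalSpace.denseSeq E n) (s : ℝ)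
      from fun z hz => ?_) ?_)
    · rw [mem_ball] at hz
      obtain ⟨s, hs0, hs⟩ := exists_rat_btwn (half_pos (sub_pos.2 hz))
      obtain ⟨n, hn⟩ := (TopologicalSpace.denseRange_denseSeq E).exists_dist_lt z hs0
      simp only [mem_iUnion, exists_prop]
      exact ⟨n, s, by linarith [dist_triangle c z (TopologicalSpace.denseSeq E n), dist_comm z c], mem_ball.2 hn⟩
    · simp only [measure_iUnion_null_iff]
      intro n s hs
      by_contra hne
      exact H ⟨n, s, hs, pos_iff_ne_zero.2 hne⟩
  · rintro ⟨n, s, hs, hpos⟩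
    refine hpos.trans_le (measure_mono fun z hz => ?_)
    rw [mem_ball] at hz ⊢
    linarith [dist_triangle z (TopologicalSpace.denseSeq E n) c, dist_comm (TopologicalSpace.denseSeq E n) c]

/-- The relative ball events are MEASURABLE (Giry ⊗ Borel), for all measures: by `measure_ball_pos_iff` each is a countable
union of products `(open set) × {μ | 0 < μ B}`. [folklore] -/
theorem measurableSet_ballEvent [TopologicalSpace.SeparableSpace E] [MeasurableSpace E] [OpensMeasurableSpace E]
    (v : E) (r : ℝ) :
    MeasurableSet {p : Measure E × E | 0 < p.1 (ball (p.2 + v) r)} := by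
  have h : {p : Measure E × E | 0 < p.1 (ball (p.2 + v) r)} = ⋃ (n : ℕ) (s : ℚ),
      Prod.snd ⁻¹' {y : E | dist (y + v) (TopologicalSpace.denseSeq E n) + s < r} ∩
        Prod.fst ⁻¹' {μ : Measure E | 0 < μ (ball (TopologicalSpace.denseSeq E n) s)} := by
    ext ⟨μ, y⟩
    simp only [mem_setOf_eq, mem_iUnion, mem_inter_iff, mem_preimage]
    exact measure_ball_pos_iff μ (y + v) r
  rw [h]
  refine MeasurableSet.iUnion fun n => MeasurableSet.iUnion fun s => MeasurableSet.inter ?_ ?_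
  · exact measurable_snd (isOpen_lt (by fun_prop) continuous_const).measurableSet
  · exact measurable_fst (measurableSet_lt measurable_const (Measure.measurable_coe measurableSet_ball))

/-- The relative ball events are ROOT-COVARIANT for every measure: `θ_y μ (B(-y + v, r)) = μ (B(v, r))`. [folklore] -/
theorem ballEvent_covariant [MeasurableSpace E] [BorelSpace E] (v : E) (r : ℝ) (μ : Measure E) (y : E) :
    (Measure.map (fun z : E => z - y) μ, -y) ∈ {p : Measure E × E | 0 < p.1 (ball (p.2 + v) r)} ↔
      (μ, (0 : E)) ∈ {p : Measure E × E | 0 < p.1 (ball (p.2 + v) r)} := by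
  simp only [mem_setOf_eq]
  rw [Measure.map_apply (measurable_sub_const y) measurableSet_ball, zero_add]
  have hpre : (fun z : E => z - y) ⁻¹' ball (-y + v) r = ball v r := by
    ext z
    rw [mem_preimage, mem_ball, mem_ball, dist_eq_norm, dist_eq_norm, show z - y - (-y + v) = z - v by abel]
  rw [hpre]

/-- On a counting measure `count|S` the relative ball event reads "`S` meets `B(y + v, r)`". [folklore] -/
theorem mem_ballEvent_count_iff [MeasurableSpace E] [OpensMeasurableSpace E] (S : Set E) (y v : E) (r : ℝ) :
    ((Measure.count : Measure E).restrict S, y) ∈ {p : Measure E × E | 0 < p.1 (ball (p.2 + v) r)} ↔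
      ∃ z ∈ S, dist z (y + v) < r := by
  simp only [mem_setOf_eq]
  rw [Measure.restrict_apply measurableSet_ball, pos_iff_ne_zero, Measure.count_ne_zero_iff]
  exact ⟨fun ⟨z, hz, hzS⟩ => ⟨z, hzS, mem_ball.1 hz⟩, fun ⟨z, hzS, hz⟩ => ⟨z, mem_ball.2 hz, hzS⟩⟩

/-- In a `δ`-separated set (`δ > 0`), `S` meets every ball `B(y, 1/(n+1))` iff `y ∈ S`: two points of `S` in a ball of
radius `< δ/2` coincide, so the points of `S` accumulating at `y` are one point at distance `0` from `y`. [folklore] -/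
theorem forall_exists_near_iff {δ : ℝ} (hδ : 0 < δ) {S : Set E}
    (hsep : ∀ x ∈ S, ∀ y ∈ S, x ≠ y → δ ≤ dist x y) (y : E) :
    (∀ n : ℕ, ∃ z ∈ S, dist z y < 1 / ((n : ℝ) + 1)) ↔ y ∈ S := by
  constructor
  · intro h
    by_contra hy
    obtain ⟨n₀, hn₀⟩ := exists_nat_one_div_lt (half_pos hδ)
    obtain ⟨x₀, hx₀S, hx₀⟩ := h n₀
    have hd : 0 < dist x₀ y := dist_pos.2 fun e => hy (e ▸ hx₀S)
    obtain ⟨n, hn⟩ := exists_nat_one_div_lt hd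
    obtain ⟨x, hxS, hx⟩ := h n
    have hxx₀ : x ≠ x₀ := by
      rintro rfl
      exact lt_irrefl _ (hx.trans hn)
    have h1 := hsep x hxS x₀ hx₀S hxx₀
    have h2 := dist_triangle_right x x₀ y
    linarith
  · intro hy n
    exact ⟨y, hy, by rw [dist_self]; exact Nat.one_div_pos_of_nat⟩

/-- CHARGED PATTERN BOXES.  For an open set `H ⊆ E⁴` of relative positions: `S` meets the four balls of radius `1/(n+1)` at
offsets `w.1, w.2.1, w.2.2.1, w.2.2.2` from `y`, for some `n` and some point `w` of the dense sequence of `E⁴` whose pattern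
box `B(w, 1/(n+1))` lies in `H`, iff four points of `S` have relative positions in `H`. [folklore] -/
theorem exists_charged_box_iff [TopologicalSpace.SeparableSpace E] {H : Set (E × E × E × E)} (hH : IsOpen H)
    (S : Set E) (y : E) :
    (∃ n : ℕ, ∃ w ∈ range (TopologicalSpace.denseSeq (E × E × E × E)), ball w (1 / ((n : ℝ) + 1)) ⊆ H ∧
        (∃ z ∈ S, dist z (y + w.1) < 1 / ((n : ℝ) + 1)) ∧ (∃ z ∈ S, dist z (y + w.2.1) < 1 / ((n : ℝ) + 1)) ∧
          (∃ z ∈ S, dist z (y + w.2.2.1) < 1 / ((n : ℝ) + 1)) ∧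
            (∃ z ∈ S, dist z (y + w.2.2.2) < 1 / ((n : ℝ) + 1))) ↔
      ∃ p q t b : E, p ∈ S ∧ q ∈ S ∧ t ∈ S ∧ b ∈ S ∧ (p - y, q - y, t - y, b - y) ∈ H := by
  -- recentred distances
  have hd : ∀ z v : E, dist (z - y) v = dist z (y + v) := fun z v => by rw [dist_eq_norm, dist_eq_norm, sub_sub]
  constructor
  · rintro ⟨n, w, -, hsub, ⟨p, hpS, hp⟩, ⟨q, hqS, hq⟩, ⟨t, htS, ht⟩, ⟨b, hbS, hb⟩⟩
    refine ⟨p, q, t, b, hpS, hqS, htS, hbS, hsub ?_⟩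
    simp only [mem_ball, Prod.dist_eq, max_lt_iff, hd]
    exact ⟨hp, hq, ht, hb⟩
  · rintro ⟨p, q, t, b, hpS, hqS, htS, hbS, hw⟩
    -- the relative positions lie in the open `H`, hence in a pattern box around a nearby point of the dense sequence
    obtain ⟨ε, hε, hball⟩ := Metric.isOpen_iff.1 hH _ hw
    obtain ⟨n, hn⟩ := exists_nat_one_div_lt (half_pos hε)
    obtain ⟨k, hk⟩ := (TopologicalSpace.denseRange_denseSeq (E × E × E × E)).exists_dist_lt
      (p - y, q - y, t - y, b - y) (Nat.one_div_pos_of_nat : (0 : ℝ) < 1 / ((n : ℝ) + 1))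
    refine ⟨n, TopologicalSpace.denseSeq (E × E × E × E) k, mem_range_self k, fun w hw' => hball ?_, ?_⟩
    · rw [mem_ball] at hw' ⊢
      linarith [dist_triangle_right w (p - y, q - y, t - y, b - y) (TopologicalSpace.denseSeq (E × E × E × E) k)]
    · simp only [Prod.dist_eq, max_lt_iff, hd] at hk
      obtain ⟨h1, h2, h3, h4⟩ := hk
      exact ⟨⟨p, hpS, h1⟩, ⟨q, hqS, h2⟩, ⟨t, htS, h3⟩, ⟨b, hbS, h4⟩⟩

/-- A bond window `a < dist < b` between two continuous functions is an open condition. [folklore] -/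
theorem isOpen_setOf_window {X : Type*} [TopologicalSpace X] {f g : X → E} (hf : Continuous f) (hg : Continuous g)
    (a b : ℝ) : IsOpen ({w | a < dist (f w) (g w)} ∩ {w | dist (f w) (g w) < b}) :=
  (isOpen_lt continuous_const (hf.dist hg)).inter (isOpen_lt (hf.dist hg) continuous_const)

/-- ASSEMBLY.  Given a family of measurable, root-covariant relative ball events `A(v, r)` reading "`S` meets `B(y + v, r)`" on
counting measures, and an open pattern set `H ⊆ E⁴` characterising a site predicate `Hex S y` (for `y ∈ S`) through the
relative positions of four witnesses in `S`, the event `C = (⋂ₙ A(0, ρₙ)) ∩ (⋃ charged pattern boxes ⊆ H)ᶜ`, `ρₙ = 1/(n+1)`,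
is measurable, root-covariant for every measure, and on counting measures of `δ`-separated sets (`δ > 0`) reads
"`y ∈ S` and not `Hex S y`". [folklore] -/
theorem exists_measurable_covariant_version [TopologicalSpace.SeparableSpace E] [MeasurableSpace E]
    (A : E → ℝ → Set (Measure E × E))
    (hAm : ∀ (v : E) (r : ℝ), MeasurableSet (A v r))
    (hAc : ∀ (v : E) (r : ℝ) (μ : Measure E) (y : E),
      (Measure.map (fun z : E => z - y) μ, -y) ∈ A v r ↔ (μ, (0 : E)) ∈ A v r)
    (hAS : ∀ (S : Set E) (y v : E) (r : ℝ),
      ((Measure.count : Measure E).restrict S, y) ∈ A v r ↔ ∃ z ∈ S, dist z (y + v) < r)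
    (Hex : Set E → E → Prop) (H : Set (E × E × E × E)) (hHo : IsOpen H)
    (hH : ∀ (S : Set E) (y : E), y ∈ S →
      (Hex S y ↔ ∃ p q t b : E, p ∈ S ∧ q ∈ S ∧ t ∈ S ∧ b ∈ S ∧ (p - y, q - y, t - y, b - y) ∈ H))
    {δ : ℝ} (hδ : 0 < δ) :
    ∃ C : Set (Measure E × E), MeasurableSet C ∧
      (∀ (μ : Measure E) (y : E), (Measure.map (fun z : E => z - y) μ, -y) ∈ C ↔ (μ, (0 : E)) ∈ C) ∧
      ∀ S : Set E, (∀ x ∈ S, ∀ y ∈ S, x ≠ y → δ ≤ dist x y) →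
        ∀ y : E, ((Measure.count : Measure E).restrict S, y) ∈ C ↔ y ∈ S ∧ ¬ Hex S y := by
  refine ⟨(⋂ n : ℕ, A 0 (1 / ((n : ℝ) + 1))) ∩
    (⋃ (n : ℕ) (w ∈ range (TopologicalSpace.denseSeq (E × E × E × E))) (_ : ball w (1 / ((n : ℝ) + 1)) ⊆ H),
      A w.1 (1 / ((n : ℝ) + 1)) ∩ (A w.2.1 (1 / ((n : ℝ) + 1)) ∩
        (A w.2.2.1 (1 / ((n : ℝ) + 1)) ∩ A w.2.2.2 (1 / ((n : ℝ) + 1)))))ᶜ, ?_, ?_, ?_⟩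
  · -- measurability: countable set operations on the `A`'s
    exact (MeasurableSet.iInter fun _ => hAm _ _).inter
      (MeasurableSet.iUnion fun _ => MeasurableSet.biUnion (countable_range _) fun _ _ =>
        MeasurableSet.iUnion fun _ => (hAm _ _).inter ((hAm _ _).inter ((hAm _ _).inter (hAm _ _)))).compl
  · -- root covariance: pushed through the set operations from the `A`'s
    intro μ y
    simp only [mem_inter_iff, mem_compl_iff, mem_iInter, mem_iUnion, hAc]
  · -- agreement on counting measures of separated sets
    intro S hsep y
    simp only [mem_inter_iff, mem_compl_iff, mem_iInter, mem_iUnion, hAS, exists_prop, add_zero]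
    have h1 := forall_exists_near_iff hδ hsep y
    have h2 := exists_charged_box_iff hHo S y
    refine ⟨fun ⟨ha, hb⟩ => ?_, fun ⟨hy, hb⟩ => ?_⟩
    · have hy : y ∈ S := h1.1 ha
      exact ⟨hy, fun hx => hb (h2.2 ((hH S y hy).1 hx))⟩
    · exact ⟨h1.2 hy, fun hb' => hb ((hH S y hy).2 (h2.1 hb'))⟩

end BallEvents

/-! ## The hexagonal pattern of the funnel window as an open condition on relative positions -/

/-- THE OPEN HEXAGONAL PATTERN SET.  There is an open `H ⊆ (ℝ³)⁴` such that a point `y ∈ S` is a hexagonal site of `S`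
(funnel window) iff four points `p, q, t, b ∈ S` have relative positions `(p - y, q - y, t - y, b - y) ∈ H`: `H` is cut out by
`t ≠ b` and the nine bond windows `0 < dist < 6/5` of `IsHexSite65`, recentred at the origin (translation invariance of the
pattern), all strict inequalities between continuous functions. [folklore] -/
theorem exists_open_hexPattern :
    ∃ H : Set (EuclideanSpace ℝ (Fin 3) × EuclideanSpace ℝ (Fin 3) × EuclideanSpace ℝ (Fin 3) × EuclideanSpace ℝ (Fin 3)),
      IsOpen H ∧ ∀ (S : Set (EuclideanSpace ℝ (Fin 3))) (y : EuclideanSpace ℝ (Fin 3)), y ∈ S →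
        (FunnelSites.IsHexSite65 S y ↔ ∃ p q t b : EuclideanSpace ℝ (Fin 3),
          p ∈ S ∧ q ∈ S ∧ t ∈ S ∧ b ∈ S ∧ (p - y, q - y, t - y, b - y) ∈ H) := by
  refine ⟨{w | w.2.2.1 ≠ w.2.2.2 ∧ (0 < dist 0 w.1 ∧ dist 0 w.1 < 6 / 5) ∧ (0 < dist 0 w.2.1 ∧ dist 0 w.2.1 < 6 / 5) ∧
      (0 < dist 0 w.2.2.1 ∧ dist 0 w.2.2.1 < 6 / 5) ∧ (0 < dist 0 w.2.2.2 ∧ dist 0 w.2.2.2 < 6 / 5) ∧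
      (0 < dist w.1 w.2.1 ∧ dist w.1 w.2.1 < 6 / 5) ∧ (0 < dist w.2.2.1 w.1 ∧ dist w.2.2.1 w.1 < 6 / 5) ∧
      (0 < dist w.2.2.1 w.2.1 ∧ dist w.2.2.1 w.2.1 < 6 / 5) ∧ (0 < dist w.2.2.2 w.1 ∧ dist w.2.2.2 w.1 < 6 / 5) ∧
      (0 < dist w.2.2.2 w.2.1 ∧ dist w.2.2.2 w.2.1 < 6 / 5)}, ?_, ?_⟩
  · -- open: finitely many strict inequalities between continuous functions
    simp only [setOf_and]
    exact IsOpen.inter (isOpen_ne_fun (by fun_prop) (by fun_prop)) <|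
      IsOpen.inter (isOpen_setOf_window (by fun_prop) (by fun_prop) _ _) <|
      IsOpen.inter (isOpen_setOf_window (by fun_prop) (by fun_prop) _ _) <|
      IsOpen.inter (isOpen_setOf_window (by fun_prop) (by fun_prop) _ _) <|
      IsOpen.inter (isOpen_setOf_window (by fun_prop) (by fun_prop) _ _) <|
      IsOpen.inter (isOpen_setOf_window (by fun_prop) (by fun_prop) _ _) <|
      IsOpen.inter (isOpen_setOf_window (by fun_prop) (by fun_prop) _ _) <|
      IsOpen.inter (isOpen_setOf_window (by fun_prop) (by fun_prop) _ _) <|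
      IsOpen.inter (isOpen_setOf_window (by fun_prop) (by fun_prop) _ _) <|
      isOpen_setOf_window (by fun_prop) (by fun_prop) _ _
  · intro S y hy
    -- translation invariance of the pattern: recentre at `y`
    have h0 : ∀ p : EuclideanSpace ℝ (Fin 3), dist 0 (p - y) = dist y p := fun p => by
      rw [← dist_sub_right y p y, sub_self]
    simp only [mem_setOf_eq, dist_sub_right, h0, ne_eq, sub_left_inj]
    constructor
    · rintro ⟨p, q, t, b, htb, ⟨-, hp, gxp⟩, ⟨-, hq, gxq⟩, ⟨-, ht, gxt⟩, ⟨-, hb, gxb⟩, ⟨-, -, gpq⟩, ⟨-, -, gtp⟩,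
        ⟨-, -, gtq⟩, ⟨-, -, gbp⟩, ⟨-, -, gbq⟩⟩
      exact ⟨p, q, t, b, hp, hq, ht, hb, htb, gxp, gxq, gxt, gxb, gpq, gtp, gtq, gbp, gbq⟩
    · rintro ⟨p, q, t, b, hp, hq, ht, hb, htb, gxp, gxq, gxt, gxb, gpq, gtp, gtq, gbp, gbq⟩
      exact ⟨p, q, t, b, htb, ⟨hy, hp, gxp⟩, ⟨hy, hq, gxq⟩, ⟨hy, ht, gxt⟩, ⟨hy, hb, gxb⟩, ⟨hp, hq, gpq⟩,
        ⟨ht, hp, gtp⟩, ⟨ht, hq, gtq⟩, ⟨hb, hp, gbp⟩, ⟨hb, hq, gbq⟩⟩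

/-! ## The stub -/

/-- **stub_cubicMarkVersion** (S1 of line `palm-good-law`, skeleton v24): A MEASURABLE ROOT-COVARIANT VERSION OF THE CUBIC
MARK.  For every `δ > 0` there is `C ⊆ (configuration, point)`, measurable (Giry ⊗ Borel) and root-covariant for every
measure (`(θ_y μ, -y) ∈ C ↔ (μ, 0) ∈ C`), which on rooted `δ`-hard-core configurations is exactly
`{(μ, y) | IsCubicSite65 (pts μ) y}`: the assembly `exists_measurable_covariant_version` fed with the relative ball events
`{(μ, y) | 0 < μ (B(y + v, r))}` (`measurableSet_ballEvent`, `ballEvent_covariant`, `mem_ballEvent_count_iff`) and the open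
hexagonal pattern set of `exists_open_hexPattern`; on `μ = count|S`, `pts μ = S` (`count_restrict_singleton_ne_zero_iff`).
[folklore] -/
theorem stub_cubicMarkVersion :
    ∀ δ : ℝ, 0 < δ →
      ∃ C : Set (Measure (EuclideanSpace ℝ (Fin 3)) × EuclideanSpace ℝ (Fin 3)), MeasurableSet C ∧
        (∀ (μ : Measure (EuclideanSpace ℝ (Fin 3))) (y : EuclideanSpace ℝ (Fin 3)),
          (Measure.map (fun z => z - y) μ, -y) ∈ C ↔ (μ, (0 : EuclideanSpace ℝ (Fin 3))) ∈ C) ∧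
        ∀ μ : Measure (EuclideanSpace ℝ (Fin 3)), IsRootedHardCore δ μ →
          ∀ y : EuclideanSpace ℝ (Fin 3), (μ, y) ∈ C ↔
            FunnelSites.IsCubicSite65 (Summit.AtomisticToContinuum.Crystallization.Theorems.PalmUnimodularRigidity.LayeredLawsSelectHcp.pts μ) y := by
  intro δ hδ
  obtain ⟨H, hHo, hH⟩ := exists_open_hexPattern
  obtain ⟨C, hCm, hCc, hCS⟩ := exists_measurable_covariant_version
    (fun (v : EuclideanSpace ℝ (Fin 3)) (r : ℝ) =>
      {p : Measure (EuclideanSpace ℝ (Fin 3)) × EuclideanSpace ℝ (Fin 3) | 0 < p.1 (ball (p.2 + v) r)})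
    measurableSet_ballEvent ballEvent_covariant mem_ballEvent_count_iff FunnelSites.IsHexSite65 H hHo hH hδ
  refine ⟨C, hCm, hCc, fun μ hμ y => ?_⟩
  obtain ⟨S, -, hsep, rfl⟩ := hμ
  -- `pts (count|S) = S`
  have hpts : pts ((Measure.count : Measure (EuclideanSpace ℝ (Fin 3))).restrict S) = S :=
    Set.ext fun z => count_restrict_singleton_ne_zero_iff S z
  rw [hCS S hsep y, hpts]
  exact Iff.rfl

end Summit.AtomisticToContinuum.Crystallization.Theorems.PalmGoodLaw.CubicMarkVersion

end
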